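import Literature.Computability.AlgebraicComplexity.SkewCircuitLinComb
import Literature.Computability.AlgebraicComplexity.SkewCircuitLinSubst
import Mathlib.RingTheory.PowerSeries.Trunc
import Mathlib.LinearAlgebra.Lagrange
import HarnessLib

/-!
# Order-`q` approximation along a curve bounds the weakly-skew complexity

BLMW 2011 §9.4, proof of Prop. 9.4.3 (the step "(9.4.1) ⇒ `f ∈ VP_ws`"): if
`g(y_1, …, y_N) = ε^q f + ε^{q+1} F̃` for `R`-linear forms `y_i` (`R = ℂ[[ε]]`), i.e. the tree's
`IsApproxAlongOrbitOfOrder g f q` (`BLMW11KroneckerApproximation.lean`), then `f` is a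
`ℂ`-linear combination of `q·deg g + 1` linear substitutions of `g` — truncate the `y_i` modulo
`ε^{q+1}` to polynomial coefficients, so that `G(e, x) := g(Ā(e)·x)` is a polynomial in `e` of
degree `≤ q·deg g` in each coefficient whose `e^q`-coefficient is `f`, and extract that coefficient by
Lagrange interpolation at the nodes `0, 1, …, q·deg g`. With the closure of the corrected `L_ws`
under linear substitution (`SkewCircuitLinSubst`) and under linear combinations
(`SkewCircuitLinComb`) this gives the quantitative bound
`ArithCircuit.wsComplexity_le_of_isApproxAlongOrbitOfOrder`:
`L_ws(f) ≤ (q·deg g + 1)·4·(N(N+1) + (2N+2)·4·L_ws(g)) + q·deg g + 2` — polynomial in `N`, `q`,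
`deg g`, `L_ws(g)`, which is what Prop. 9.4.3 uses ("then `f ∈ VP_ws`" when `q` is polynomially
bounded). No new facts. [cite: BurgisserEtAl2011, §9.4 (proof of Prop. 9.4.3)]

## References
* [BurgisserEtAl2011] Bürgisser–Landsberg–Manivel–Weyman 2011, §9.4, (9.4.1) and Prop. 9.4.3.
-/

universe u

open MvPolynomial

namespace Literature.Computability.AlgebraicComplexity

namespace ArithCircuit

namespace ApproxOrder

/-- The coercion `ℂ[e] → ℂ[[ε]]` as a ring homomorphism. [folklore] -/
noncomputable abbrev iota : Polynomial ℂ →+* PowerSeries ℂ :=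
  Polynomial.coeToPowerSeries.ringHom

variable {N : ℕ}

/-- **Congruent substitutions agree modulo the ideal**: if two matrices agree modulo an ideal `I`,
the two linear substitutions of any polynomial agree after reduction modulo `I`.
[cite: BurgisserEtAl2011, §9.4 (proof of Prop. 9.4.3)] -/
theorem map_mk_linSubst_congr {S : Type u} [CommRing S] (I : Ideal S)
    {A A' : Matrix (Fin N) (Fin N) S}
    (h : ∀ i j, Ideal.Quotient.mk I (A i j) = Ideal.Quotient.mk I (A' i j))
    (p : MvPolynomial (Fin N) S) :
    MvPolynomial.map (Ideal.Quotient.mk I) (linSubst (Fin N) S A p) =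
      MvPolynomial.map (Ideal.Quotient.mk I) (linSubst (Fin N) S A' p) := by
  have key : (MvPolynomial.map (Ideal.Quotient.mk I)).comp (linSubst (Fin N) S A).toRingHom =
      (MvPolynomial.map (Ideal.Quotient.mk I)).comp (linSubst (Fin N) S A').toRingHom := by
    apply MvPolynomial.ringHom_ext
    · intro r
      simp
    · intro i
      simp [linSubst_X, map_sum, smul_eq_C_mul, h]
  exact DFunLike.congr_fun key p

/-- **Base change of a linear substitution** along a ring homomorphism `φ`.
[cite: BurgisserEtAl2011, §9.4 (proof of Prop. 9.4.3)] -/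
theorem map_linSubst {S T : Type u} [CommRing S] [CommRing T] (φ : S →+* T)
    (B : Matrix (Fin N) (Fin N) S) (p : MvPolynomial (Fin N) S) :
    MvPolynomial.map φ (linSubst (Fin N) S B p) =
      linSubst (Fin N) T (B.map φ) (MvPolynomial.map φ p) := by
  have key : (MvPolynomial.map φ).comp (linSubst (Fin N) S B).toRingHom =
      (linSubst (Fin N) T (B.map φ)).toRingHom.comp (MvPolynomial.map φ) := by
    apply MvPolynomial.ringHom_ext
    · intro r
      simp
    · intro i
      simp [linSubst_X, map_sum, smul_eq_C_mul, Matrix.map_apply]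
  exact DFunLike.congr_fun key p

/-- The weight (total degree) of a monomial. [folklore] -/
private abbrev wt (m : Fin N →₀ ℕ) : ℕ := m.sum fun _ e => e

omit N in
/-- Additivity of the weight. [folklore] -/
private theorem wt_add {N : ℕ} (a b : Fin N →₀ ℕ) : wt (a + b) = wt a + wt b :=
  Finsupp.sum_add_index' (fun _ => rfl) (fun _ _ _ => rfl)

/-- The coefficient-degree predicate: every `x`-coefficient of `H ∈ ℂ[e][x]` has `e`-degree at most
`q ·` (weight of the monomial). [cite: BurgisserEtAl2011, §9.4 (proof of Prop. 9.4.3)] -/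
def DegBnd (q : ℕ) (H : MvPolynomial (Fin N) (Polynomial ℂ)) : Prop :=
  ∀ m, (MvPolynomial.coeff m H).natDegree ≤ q * wt m

/-- `DegBnd` is additive. [folklore] -/
private theorem degBnd_add {q : ℕ} {H H' : MvPolynomial (Fin N) (Polynomial ℂ)} (h : DegBnd q H)
    (h' : DegBnd q H') : DegBnd q (H + H') := fun m => by
  rw [MvPolynomial.coeff_add]
  exact (Polynomial.natDegree_add_le _ _).trans (max_le (h m) (h' m))

/-- `DegBnd` is multiplicative. [folklore] -/
private theorem degBnd_mul {q : ℕ} {H H' : MvPolynomial (Fin N) (Polynomial ℂ)} (h : DegBnd q H)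
    (h' : DegBnd q H') : DegBnd q (H * H') := fun m => by
  rw [MvPolynomial.coeff_mul]
  refine Polynomial.natDegree_sum_le_of_forall_le _ _ fun x hx => ?_
  have hx' : x.1 + x.2 = m := by simpa using hx
  calc (MvPolynomial.coeff x.1 H * MvPolynomial.coeff x.2 H').natDegree
      ≤ (MvPolynomial.coeff x.1 H).natDegree + (MvPolynomial.coeff x.2 H').natDegree :=
        Polynomial.natDegree_mul_le
    _ ≤ q * wt x.1 + q * wt x.2 := add_le_add (h _) (h' _)
    _ = q * wt m := by rw [← mul_add, ← wt_add, hx']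

/-- Constants satisfy `DegBnd`. [folklore] -/
private theorem degBnd_C {q : ℕ} (c : ℂ) : DegBnd (N := N) q (C (Polynomial.C c)) := fun m => by
  rw [MvPolynomial.coeff_C]
  split_ifs <;> simp

/-- A linear form with coefficients of degree `≤ q` satisfies `DegBnd`. [folklore] -/
private theorem degBnd_linForm {q : ℕ} (b : Fin N → Polynomial ℂ) (hb : ∀ j, (b j).natDegree ≤ q) :
    DegBnd (N := N) q (∑ j, b j • (X j : MvPolynomial (Fin N) (Polynomial ℂ))) := fun m => by
  rw [MvPolynomial.coeff_sum]
  refine Polynomial.natDegree_sum_le_of_forall_le _ _ fun j _ => ?_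
  rw [MvPolynomial.coeff_smul, MvPolynomial.coeff_X]
  split_ifs with hm
  · subst hm
    simpa [wt] using hb j
  · simp

variable (q : ℕ) (A : Matrix (Fin N) (Fin N) (PowerSeries ℂ)) (g : MvPolynomial (Fin N) ℂ)

/-- The truncated coefficient matrix `Ā = A mod ε^{q+1}`, with polynomial entries of degree `≤ q`.
[cite: BurgisserEtAl2011, §9.4 (proof of Prop. 9.4.3)] -/
noncomputable def truncMat : Matrix (Fin N) (Fin N) (Polynomial ℂ) :=
  fun i j => PowerSeries.trunc (q + 1) (A i j)

/-- `G(e, x) := g(Ā(e)·x) ∈ ℂ[e][x]`. [cite: BurgisserEtAl2011, §9.4 (proof of Prop. 9.4.3)] -/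
noncomputable def bigG : MvPolynomial (Fin N) (Polynomial ℂ) :=
  linSubst (Fin N) (Polynomial ℂ) (truncMat q A) (MvPolynomial.map (algebraMap ℂ (Polynomial ℂ)) g)

/-- `Ā ≡ A (mod ε^{q+1})` entrywise. [folklore] -/
private theorem X_pow_dvd_sub_trunc (φ : PowerSeries ℂ) :
    PowerSeries.X ^ (q + 1) ∣ φ - iota (PowerSeries.trunc (q + 1) φ) := by
  rw [PowerSeries.X_pow_dvd_iff]
  intro m hm
  rw [map_sub, show iota (PowerSeries.trunc (q + 1) φ) =
    ((PowerSeries.trunc (q + 1) φ : Polynomial ℂ) : PowerSeries ℂ) from rfl,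
    Polynomial.coeff_coe, PowerSeries.coeff_trunc, if_pos hm, sub_self]

/-- **Every coefficient of `G` has degree at most `q·(weight)`.** [cite: BurgisserEtAl2011, §9.4 (proof of Prop. 9.4.3)] -/
theorem degBnd_bigG : DegBnd q (bigG q A g) := by
  unfold bigG
  induction g using MvPolynomial.induction_on with
  | C c =>
    rw [MvPolynomial.map_C, linSubst_C, Polynomial.algebraMap_eq]
    exact degBnd_C c
  | add p p' hp hp' =>
    rw [map_add, map_add]
    exact degBnd_add hp hp'
  | mul_X p i hp =>
    rw [map_mul, map_mul, MvPolynomial.map_X, linSubst_X]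
    refine degBnd_mul hp (degBnd_linForm _ fun j => ?_)
    exact Nat.lt_succ_iff.1 (PowerSeries.natDegree_trunc_lt _ _)

omit N in
/-- A linear substitution does not raise the total degree. [cite: MulmuleySohoni2001, §4] -/
theorem totalDegree_linSubst_le {N : ℕ} {S : Type u} [CommRing S] (B : Matrix (Fin N) (Fin N) S)
    (p : MvPolynomial (Fin N) S) : (linSubst (Fin N) S B p).totalDegree ≤ p.totalDegree := by
  classical
  have hℓ : ∀ i : Fin N, MvPolynomial.totalDegree
      (∑ j, B j i • (X j : MvPolynomial (Fin N) S)) ≤ 1 := fun i => by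
    refine (MvPolynomial.totalDegree_finsetSum _ _).trans (Finset.sup_le fun j _ => ?_)
    rw [smul_eq_C_mul]
    refine (MvPolynomial.totalDegree_mul _ _).trans ?_
    simp only [MvPolynomial.totalDegree_C, zero_add]
    calc MvPolynomial.totalDegree (X j : MvPolynomial (Fin N) S)
        = MvPolynomial.totalDegree (monomial (Finsupp.single j 1) (1 : S)) := rfl
      _ ≤ (Finsupp.single j 1).sum fun _ e => e := MvPolynomial.totalDegree_monomial_le _ _
      _ = 1 := by simp
  conv_lhs => rw [p.as_sum]
  rw [map_sum]
  refine (MvPolynomial.totalDegree_finsetSum _ _).trans (Finset.sup_le fun m hm => ?_)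
  have hmono : linSubst (Fin N) S B (monomial m (MvPolynomial.coeff m p)) =
      C (MvPolynomial.coeff m p) * m.prod fun i e => (∑ j, B j i • (X j : MvPolynomial (Fin N) S)) ^ e := by
    unfold linSubst
    rw [MvPolynomial.aeval_monomial, MvPolynomial.algebraMap_eq]
  rw [hmono]
  refine (MvPolynomial.totalDegree_mul _ _).trans ?_
  simp only [MvPolynomial.totalDegree_C, zero_add]
  refine (MvPolynomial.totalDegree_finsetProd _ _).trans ?_
  calc ∑ i ∈ m.support, MvPolynomial.totalDegree
        ((∑ j, B j i • (X j : MvPolynomial (Fin N) S)) ^ m i)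
      ≤ ∑ i ∈ m.support, m i := Finset.sum_le_sum fun i _ =>
          (MvPolynomial.totalDegree_pow _ _).trans (by simpa using Nat.mul_le_mul_left (m i) (hℓ i))
    _ ≤ p.totalDegree := MvPolynomial.le_totalDegree hm

/-- `G` has total degree at most that of `g`. [cite: BurgisserEtAl2011, §9.4 (proof of Prop. 9.4.3)] -/
theorem totalDegree_bigG_le : (bigG q A g).totalDegree ≤ g.totalDegree := by
  refine (totalDegree_linSubst_le _ _).trans ?_
  unfold MvPolynomial.totalDegree
  exact Finset.sup_mono (MvPolynomial.support_map_subset _ _)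

variable {q A g} {f : MvPolynomial (Fin N) ℂ}

/-- **The `e^q`-coefficient of `G` is `f`**, coefficientwise, when `g(A·x) = ε^q f + ε^{q+1} F̃`.
[cite: BurgisserEtAl2011, §9.4 (proof of Prop. 9.4.3)] -/
theorem coeff_bigG_coeff_q {F : MvPolynomial (Fin N) (PowerSeries ℂ)}
    (hAF : linSubst (Fin N) (PowerSeries ℂ) A (MvPolynomial.map (algebraMap ℂ (PowerSeries ℂ)) g) =
      C (PowerSeries.X ^ q) * MvPolynomial.map (algebraMap ℂ (PowerSeries ℂ)) f +
        C (PowerSeries.X ^ (q + 1)) * F) (m : Fin N →₀ ℕ) :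
    (MvPolynomial.coeff m (bigG q A g)).coeff q = MvPolynomial.coeff m f := by
  set I : Ideal (PowerSeries ℂ) := Ideal.span {PowerSeries.X ^ (q + 1)} with hI
  -- A ≡ ι(Ā) mod I
  have hcong := map_mk_linSubst_congr I (A := A) (A' := (truncMat q A).map iota)
    (fun i j => (Ideal.Quotient.eq.2 (Ideal.mem_span_singleton.2 (X_pow_dvd_sub_trunc q (A i j)))))
    (MvPolynomial.map (algebraMap ℂ (PowerSeries ℂ)) g)
  -- base change: linSubst (ι Ā) (g ⊗ R) = map ι G
  have halg : iota.comp (algebraMap ℂ (Polynomial ℂ)) = algebraMap ℂ (PowerSeries ℂ) := by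
    ext c
    simp [Polynomial.algebraMap_eq, PowerSeries.C_eq_algebraMap]
  have hbase : linSubst (Fin N) (PowerSeries ℂ) ((truncMat q A).map iota)
      (MvPolynomial.map (algebraMap ℂ (PowerSeries ℂ)) g) = MvPolynomial.map iota (bigG q A g) := by
    rw [bigG, map_linSubst, MvPolynomial.map_map, halg]
  rw [hbase, hAF] at hcong
  -- compare the coefficients of the monomial `m`, then the `ε^q`-coefficients
  have hm := congrArg (MvPolynomial.coeff m) hcong
  rw [MvPolynomial.coeff_map, MvPolynomial.coeff_map, Ideal.Quotient.eq,
    Ideal.mem_span_singleton, PowerSeries.X_pow_dvd_iff] at hm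
  have hq := hm q (Nat.lt_succ_self q)
  rw [map_sub, sub_eq_zero, MvPolynomial.coeff_add, MvPolynomial.coeff_C_mul,
    MvPolynomial.coeff_C_mul, MvPolynomial.coeff_map, MvPolynomial.coeff_map, map_add,
    PowerSeries.coeff_X_pow_mul', PowerSeries.coeff_X_pow_mul', if_pos le_rfl,
    if_neg (by omega), add_zero, Nat.sub_self] at hq
  rw [show (iota (MvPolynomial.coeff m (bigG q A g))) =
      ((MvPolynomial.coeff m (bigG q A g) : Polynomial ℂ) : PowerSeries ℂ) from rfl,
    Polynomial.coeff_coe] at hq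
  rw [← hq]
  simp

/-- Evaluating `e` at a scalar turns `G` into a linear substitution of `g`.
[cite: BurgisserEtAl2011, §9.4 (proof of Prop. 9.4.3)] -/
theorem map_eval_bigG (z : ℂ) :
    MvPolynomial.map (Polynomial.evalRingHom z) (bigG q A g) =
      linSubst (Fin N) ℂ ((truncMat q A).map (Polynomial.evalRingHom z)) g := by
  have hid : (Polynomial.evalRingHom z).comp (algebraMap ℂ (Polynomial ℂ)) = RingHom.id ℂ := by
    ext c
    simp [Polynomial.algebraMap_eq]
  rw [bigG, map_linSubst, MvPolynomial.map_map, hid, MvPolynomial.map_id]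

/-- **`f` is a linear combination of `q·deg g + 1` linear substitutions of `g`** (Lagrange
interpolation of the `e^q`-coefficient at the nodes `0, …, q·deg g`).
[cite: BurgisserEtAl2011, §9.4 (proof of Prop. 9.4.3)] -/
theorem eq_sum_smul_linSubst {F : MvPolynomial (Fin N) (PowerSeries ℂ)}
    (hAF : linSubst (Fin N) (PowerSeries ℂ) A (MvPolynomial.map (algebraMap ℂ (PowerSeries ℂ)) g) =
      C (PowerSeries.X ^ q) * MvPolynomial.map (algebraMap ℂ (PowerSeries ℂ)) f +
        C (PowerSeries.X ^ (q + 1)) * F) :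
    ∃ (c : Fin (q * g.totalDegree + 1) → ℂ),
      f = ∑ k, c k • linSubst (Fin N) ℂ ((truncMat q A).map (Polynomial.evalRingHom (k : ℂ))) g := by
  classical
  -- nodes 0, …, D and the Lagrange coefficients of `e^q`
  have hv : Set.InjOn (fun k : Fin (q * g.totalDegree + 1) => ((k : ℕ) : ℂ))
      (↑(Finset.univ : Finset (Fin (q * g.totalDegree + 1)))) := fun a _ b _ h => by
    have h' : ((a : ℕ) : ℂ) = ((b : ℕ) : ℂ) := h
    have : (a : ℕ) = (b : ℕ) := by exact_mod_cast h'
    exact Fin.ext this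
  refine ⟨fun k => (Lagrange.basis Finset.univ (fun k : Fin (q * g.totalDegree + 1) => ((k : ℕ) : ℂ))
    k).coeff q, ?_⟩
  ext m
  rw [MvPolynomial.coeff_sum]
  simp only [MvPolynomial.coeff_smul, smul_eq_mul]
  -- the coefficient polynomial `p := coeff_m G` has degree ≤ D
  have hdeg : (MvPolynomial.coeff m (bigG q A g)).natDegree ≤ q * g.totalDegree := by
    by_cases hms : m ∈ (bigG q A g).support
    · exact (degBnd_bigG q A g m).trans (Nat.mul_le_mul_left q
        ((MvPolynomial.le_totalDegree hms).trans (totalDegree_bigG_le q A g)))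
    · rw [MvPolynomial.notMem_support_iff] at hms
      rw [hms]
      simp
  have hdeg' : (MvPolynomial.coeff m (bigG q A g)).degree <
      ((Finset.univ : Finset (Fin (q * g.totalDegree + 1))).card : WithBot ℕ) := by
    rw [Finset.card_univ, Fintype.card_fin]
    exact (Polynomial.degree_le_of_natDegree_le hdeg).trans_lt
      (by exact_mod_cast Nat.lt_succ_self _)
  have hL := Lagrange.eq_interpolate hv hdeg'
  rw [Lagrange.interpolate_apply] at hL
  have hcoef := congrArg (fun r : Polynomial ℂ => r.coeff q) hL
  simp only [Polynomial.finsetSum_coeff, Polynomial.coeff_C_mul] at hcoef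
  rw [← coeff_bigG_coeff_q hAF m, hcoef]
  refine Finset.sum_congr rfl fun k _ => ?_
  rw [mul_comm, ← map_eval_bigG, MvPolynomial.coeff_map]
  rfl

end ApproxOrder

/-- **Order-`q` approximation along a curve in the orbit of `g` bounds `L_ws(f)` polynomially**
(BLMW 2011 §9.4, the mechanism of Prop. 9.4.3): if `IsApproxAlongOrbitOfOrder g f q` then
`L_ws(f) ≤ (q·deg g + 1)·4·(N(N+1) + (2N+2)·4·L_ws(g)) + (q·deg g + 2)`.
[cite: BurgisserEtAl2011, §9.4 (proof of Prop. 9.4.3)] -/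
theorem wsComplexity_le_of_isApproxAlongOrbitOfOrder {N q : ℕ} {g f : MvPolynomial (Fin N) ℂ}
    (h : IsApproxAlongOrbitOfOrder g f q) :
    wsComplexity f ≤
      (q * g.totalDegree + 1) * (4 * (N * (N + 1) + (2 * N + 2) * (4 * wsComplexity g))) +
        (q * g.totalDegree + 1 + 1) := by
  obtain ⟨A, F, hAF⟩ := h
  obtain ⟨c, hf⟩ := ApproxOrder.eq_sum_smul_linSubst (q := q) (A := A) (g := g) (f := f) hAF
  rw [hf]
  refine (wsComplexity_sum_smul_le _ _ _).trans ?_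
  rw [Finset.card_univ, Fintype.card_fin]
  refine Nat.add_le_add_right ?_ _
  calc ∑ k : Fin (q * g.totalDegree + 1), 4 * wsComplexity
        (linSubst (Fin N) ℂ ((ApproxOrder.truncMat q A).map (Polynomial.evalRingHom ((k : ℕ) : ℂ))) g)
      ≤ ∑ _k : Fin (q * g.totalDegree + 1),
          4 * (N * (N + 1) + (2 * N + 2) * (4 * wsComplexity g)) := by
        refine Finset.sum_le_sum fun k _ => Nat.mul_le_mul_left 4 ?_
        simpa [Fintype.card_fin] using wsComplexity_linSubst_le
          ((ApproxOrder.truncMat q A).map (Polynomial.evalRingHom ((k : ℕ) : ℂ))) g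
    _ = (q * g.totalDegree + 1) * (4 * (N * (N + 1) + (2 * N + 2) * (4 * wsComplexity g))) := by
        rw [Finset.sum_const, Finset.card_univ, Fintype.card_fin, smul_eq_mul]

end ArithCircuit

end Literature.Computability.AlgebraicComplexity
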